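import Summits.Ventures.Crystal3D.LocalLP.DodecahedralVolume
import Summits.Ventures.Crystal3D.LocalLP.H1KeplerInstance
import Summits.Ventures.Crystal3D.StatusLinks
import Literature.Geometry.DiscreteGeometry.ExposedSurfaceIsoperimetric
import Literature.Geometry.DiscreteGeometry.DoubledBallsUnionDensity
import Mathlib.Analysis.Real.Pi.Bounds
import HarnessLib

/-!
# Isoperimetric inputs from density theorems: H2 (dodecahedral bound) and H1′ (Kepler)

HONEST FRAMING. Part of the venture `Summits/Ventures/Crystal3D` (cell `pub-crystal3d`). This file
(1) DERIVES the named input `IsoInput rH2 sH2` of headline H2 (`LocalLP/H2Instance.lean`: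
`rH2 = 1783/2000`, `sH2 = (9474878467/625000000) / (4π · 1.783²)`, engine-2's certified surface
constant `S ≈ 15.1598 = 4π · 0.7547^{-2/3}` rounded down) — and more generally
`IsoInput r (S/(4π(2r)²))` for every probing radius with `2r ≥ √2` — from TWO Literature named
facts: `HalesDSP_truncatedDodecahedral` (Hales–McLaughlin dodecahedral bound in truncated form,
Bezdek–Reid Thm 7; computer-assisted in print) and `Federer1969_isoperimetricUnionBalls`
(isoperimetric inequality for finite unions of balls, Federer 3.2.43) — neither proved in the
tree — through `volume_iUnion_closedBall_ge_dodeca` (`DodecahedralVolume.lean`), the Literature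
corollary `Federer1969_isoperimetricUnionBalls.sphereFraction_sum_cube_of_le_volume`
(`ExposedSurfaceIsoperimetric.lean`, proved there), the scale identification of exposed
directions, and the kernel-checked certificate `S³ · 0.7547² ≤ 64π³` (π to 20 digits);
consequence `surfaceBound_H2_classical : flyspeck_L12 → LevyCapInput rH2 FH2 →
HalesDSP_truncatedDodecahedral → Federer1969… → SurfaceBound (79/25)`.
(2) DERIVES the input `IsoInput 1 sKepler` of headline H1′ (`LocalLP/H1KeplerInstance.lean`,
`sKepler = 15.353/16π`) from `Bezdek2002_doubledBallsUnion` (Kepler's bound `π/√18` in Bezdek's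
doubled-balls form, Bezdek–Khan Thm 7.3; rests on Hales's proof of the Kepler conjecture; NOT
proved in the tree) and Federer: the union of the radius-`2` balls about the doubled centres has
volume `≥ 4√2 N`, so exposed area `≥ (1152π)^{1/3} N^{2/3} ≥ 15.353 N^{2/3}`; consequence
`surfaceBound_H1K_classical : LevyCapInput 1 FH1 → Bezdek2002_doubledBallsUnion → Federer1969… →
SurfaceBound (281/100)`.
The cap tables `FH1`, `FH2` remain the cell's certified CELL5 + Lévy inputs `(L)` (hypotheses);
`flyspeck_L12` is Flyspeck's computer-verified lemma (named fact). No crystallization statement is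
claimed.
-/

noncomputable section

open scoped BigOperators
open Real Finset MeasureTheory

namespace Summit.Ventures.Crystal3D

open Literature.Geometry.DiscreteGeometry (sphereFraction exposedDirections sphereFraction_sphere
  Federer1969_isoperimetricUnionBalls HalesDSP_truncatedDodecahedral flyspeck_L12
  Bezdek2002_doubledBallsUnion volume_iUnion_closedBall_two_lt_top)

variable {N : ℕ}

/-- Scale invariance of exposed directions: the doubled configuration probed at radius `2r` has
the same exposed directions as `x` probed at radius `r`. -/
theorem exposedDirections_two_smul (x : Fin N → EuclideanSpace ℝ (Fin 3)) (r : ℝ) (i : Fin N) :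
    exposedDirections (fun j => (2 : ℝ) • x j) (2 * r) i = exposedCap x r i := by
  ext u
  simp only [exposedDirections, exposedCap, Set.mem_setOf_eq]
  refine and_congr_right fun _ => forall_congr' fun j => imp_congr_right fun _ => ?_
  have : (2 : ℝ) • x i + (2 * r) • u = (2 : ℝ) • (x i + r • u) := by
    rw [smul_add, smul_smul, mul_comm]
  rw [this, dist_two_smul]
  constructor
  · intro h; linarith
  · intro h; linarith

/-- The certificate behind engine-2's surface constant: `S = 9474878467/625000000` satisfies
`S³ · 0.7547² ≤ 64 π³`, i.e. `S ≤ 4π · 0.7547^{-2/3}` (π to 20 digits, `Real.pi_gt_d20`). -/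
theorem sH2_certificate :
    (9474878467 / 625000000 : ℝ) ^ 3 * (0.7547 : ℝ) ^ 2 ≤ 64 * π ^ 3 := by
  have hπ := Real.pi_gt_d20
  have h3 : (3.14159265358979323846 : ℝ) ^ 3 ≤ π ^ 3 :=
    pow_le_pow_left₀ (by norm_num) hπ.le 3
  have hnum : (9474878467 / 625000000 : ℝ) ^ 3 * (0.7547 : ℝ) ^ 2 ≤
      64 * (3.14159265358979323846 : ℝ) ^ 3 := by norm_num
  linarith

/-- `√2 ≤ 1.783` (the probing radius of H2 in radius-`1` units exceeds the truncation radius). -/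
theorem sqrt_two_le_two_mul_rH2 : Real.sqrt 2 ≤ 2 * rH2 := by
  rw [show 2 * rH2 = (1783 / 1000 : ℝ) by norm_num [rH2]]
  rw [Real.sqrt_le_left (by norm_num)]
  norm_num

/-- **`(I)` from the dodecahedral bound and Federer, at any probing radius `r` with
`2r ≥ √2`** (radius-`1` picture: probing spheres of radius `2r` contain the truncated Voronoi
cells): `∑ᵢ exposedFraction x r i ≥ S/(4π(2r)²) · N^{2/3}` with `S = 9474878467/625000000 ≤
4π · 0.7547^{-2/3}`. -/
theorem isoInput_of_dod_federer (hD : HalesDSP_truncatedDodecahedral)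
    (hF : Federer1969_isoperimetricUnionBalls) {r : ℝ} (hr2 : Real.sqrt 2 ≤ 2 * r) :
    IsoInput r (9474878467 / 625000000 / (4 * π * (2 * r) ^ 2)) := by
  intro N x hx
  have hπ : 0 < π := pi_pos
  set v : ℝ := (4 * π / 3) / 0.7547 with hv
  have hv0 : 0 ≤ (N : ℝ) * v := by positivity
  -- volume of the union of the probing balls (radius-1 picture)
  have hvol := volume_iUnion_closedBall_ge_dodeca hD hx hr2
  have hr : 0 < 2 * r := lt_of_lt_of_le (Real.sqrt_pos.2 (by norm_num)) hr2
  -- Federer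
  have hFed := Federer1969_isoperimetricUnionBalls.sphereFraction_sum_cube_of_le_volume hF
    (fun i => (2 : ℝ) • x i) hr hv0 hvol
  simp_rw [exposedDirections_two_smul] at hFed
  -- back to the venture's vocabulary
  have hS : ∑ i, sphereFraction (exposedCap x r i) = ∑ i, exposedFraction x r i := rfl
  rw [hS] at hFed
  set S := ∑ i, exposedFraction x r i with hSdef
  have hS0 : 0 ≤ S := Finset.sum_nonneg fun i _ => exposedFraction_nonneg x r i
  set c : ℝ := 4 * π * (2 * r) ^ 2 with hcdef
  have hcpos : 0 < c := by positivity
  set T := c * S with hT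
  have hT0 : 0 ≤ T := by positivity
  -- `T³ ≥ 36π (N v)² = N² · 64π³/0.7547² ≥ N² · S_H2³`
  set Srat : ℝ := 9474878467 / 625000000 with hSrat
  have hkey : 36 * π * ((N : ℝ) * v) ^ 2 = (N : ℝ) ^ 2 * (64 * π ^ 3 / (0.7547 : ℝ) ^ 2) := by
    rw [hv]; field_simp; ring
  have hcert : Srat ^ 3 ≤ 64 * π ^ 3 / (0.7547 : ℝ) ^ 2 := by
    rw [le_div_iff₀ (by norm_num)]; exact sH2_certificate
  have hcube : (Srat * (N : ℝ) ^ ((2 : ℝ) / 3)) ^ 3 ≤ T ^ 3 := by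
    have hN23 : ((N : ℝ) ^ ((2 : ℝ) / 3)) ^ 3 = (N : ℝ) ^ 2 := by
      rw [← Real.rpow_natCast, ← Real.rpow_mul (Nat.cast_nonneg N)]; norm_num
    calc (Srat * (N : ℝ) ^ ((2 : ℝ) / 3)) ^ 3 = Srat ^ 3 * (N : ℝ) ^ 2 := by rw [mul_pow, hN23]
      _ ≤ (64 * π ^ 3 / (0.7547 : ℝ) ^ 2) * (N : ℝ) ^ 2 :=
          mul_le_mul_of_nonneg_right hcert (by positivity)
      _ = 36 * π * ((N : ℝ) * v) ^ 2 := by rw [hkey]; ring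
      _ ≤ T ^ 3 := hFed
  have hTge : Srat * (N : ℝ) ^ ((2 : ℝ) / 3) ≤ T := by
    by_contra hlt
    have hlt' : T < Srat * (N : ℝ) ^ ((2 : ℝ) / 3) := not_le.1 hlt
    have : T ^ 3 < (Srat * (N : ℝ) ^ ((2 : ℝ) / 3)) ^ 3 := pow_lt_pow_left₀ hlt' hT0 (by norm_num)
    linarith
  -- divide by `c = 4π(2r)²`
  calc Srat / c * (N : ℝ) ^ ((2 : ℝ) / 3) = (Srat * (N : ℝ) ^ ((2 : ℝ) / 3)) / c := by
        field_simp
    _ ≤ T / c := div_le_div_of_nonneg_right hTge hcpos.le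
    _ = S := by rw [hT]; field_simp

/-- **H2's `(I)` from the dodecahedral bound and Federer** (`r = rH2 = 1783/2000`). -/
theorem isoInput_H2_of_dod_federer (hD : HalesDSP_truncatedDodecahedral)
    (hF : Federer1969_isoperimetricUnionBalls) : IsoInput rH2 sH2 := by
  have h := isoInput_of_dod_federer hD hF sqrt_two_le_two_mul_rH2
  have e : sH2 = 9474878467 / 625000000 / (4 * π * (2 * rH2) ^ 2) := by
    simp only [sH2, cH2, rH2]; norm_num
  rw [e]; exact h

/-- **H2 on named literature facts only (plus the cell's certified cap table)**:
`SurfaceBound (79/25)`, i.e. `C(x) < 6N - 3.16 N^{2/3}` for every packing of `N ≥ 2`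
diameter-`1` balls in `ℝ³`, from Flyspeck's `L12`, the dodecahedral bound, Federer's
inequality and the cap input `(L)` at `rH2` with engine-2's table. -/
theorem surfaceBound_H2_classical (hL12 : flyspeck_L12) (hL : LevyCapInput rH2 FH2)
    (hD : HalesDSP_truncatedDodecahedral) (hF : Federer1969_isoperimetricUnionBalls) :
    SurfaceBound (79 / 25) :=
  surfaceBound_H2_rung hL12 hL (isoInput_H2_of_dod_federer hD hF)

/-! ## H1′: the Kepler surface constant -/

/-- A lone ball is fully exposed: for `N = 1` the exposed fraction is `1`. -/
theorem exposedFraction_fin_one (x : Fin 1 → EuclideanSpace ℝ (Fin 3)) (r : ℝ) :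
    exposedFraction x r 0 = 1 := by
  have h : exposedCap x r 0 = {u : EuclideanSpace ℝ (Fin 3) | ‖u‖ = 1} := by
    ext u
    simp only [exposedCap, Set.mem_setOf_eq, and_iff_left_iff_imp]
    intro _ j hj
    exact absurd (Subsingleton.elim j 0) hj
  show sphereFraction (exposedCap x r 0) = 1
  rw [h, sphereFraction_sphere]

/-- Under the Kepler bound in doubled-balls form, the union of the radius-`2` balls about the
doubled centres of a packing of `N ≥ 2` diameter-`1` balls has volume at least `4√2 · N`. -/
theorem volume_iUnion_closedBall_two_ge_kepler (hK : Bezdek2002_doubledBallsUnion)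
    {x : Fin N → EuclideanSpace ℝ (Fin 3)} (hx : IsUnitPacking x) (hN : 2 ≤ N) :
    ENNReal.ofReal ((N : ℝ) * (4 * Real.sqrt 2)) ≤
      volume (⋃ i, Metric.closedBall ((2 : ℝ) • x i) (2 : ℝ)) := by
  obtain ⟨hinj, hV⟩ := (isUnitPacking_iff_two_smul x).1 hx
  have hK' := hK N (fun i => (2 : ℝ) • x i) hN hinj hV
  have htop := volume_iUnion_closedBall_two_lt_top (fun i => (2 : ℝ) • x i)
  set U := volume (⋃ i, Metric.closedBall ((2 : ℝ) • x i) (2 : ℝ)) with hU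
  have hU' : U = ENNReal.ofReal U.toReal := (ENNReal.ofReal_toReal htop.ne).symm
  have hπ : 0 < π := pi_pos
  have h18 : 0 < Real.sqrt 18 := Real.sqrt_pos.2 (by norm_num)
  rw [hU', ← ENNReal.ofReal_mul (by positivity),
    ENNReal.ofReal_le_ofReal_iff (by positivity)] at hK'
  -- `hK' : N · 4π/3 ≤ (π/√18) · U.toReal`
  have h1 : (N : ℝ) * (4 * π / 3) * Real.sqrt 18 ≤ π * U.toReal := by
    have := mul_le_mul_of_nonneg_right hK' h18.le
    calc (N : ℝ) * (4 * π / 3) * Real.sqrt 18 ≤ π / Real.sqrt 18 * U.toReal * Real.sqrt 18 := this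
      _ = π * U.toReal := by field_simp
  have h18eq : Real.sqrt 18 = 3 * Real.sqrt 2 := by   -- `√18 = 3√2` (cf. `sqrt_eighteen_eq`)
    rw [show (18 : ℝ) = 3 ^ 2 * 2 by norm_num, Real.sqrt_mul (by norm_num), Real.sqrt_sq (by norm_num)]
  rw [h18eq] at h1
  have h2 : π * ((N : ℝ) * (4 * Real.sqrt 2)) ≤ π * U.toReal := by linarith
  rw [hU']
  exact ENNReal.ofReal_le_ofReal (le_of_mul_le_mul_left h2 hπ)

/-- **H1′'s `(I)` from Kepler (doubled-balls form) and Federer.** -/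
theorem isoInput_one_of_kepler (hK : Bezdek2002_doubledBallsUnion)
    (hF : Federer1969_isoperimetricUnionBalls) : IsoInput 1 sKepler := by
  intro N x hx
  rcases Nat.lt_or_ge N 2 with hN | hN
  · interval_cases N
    · simp [Real.zero_rpow]
    · rw [Fin.sum_univ_one, exposedFraction_fin_one]
      have hc : 16 * (3 : ℝ) < cH1 := by unfold cH1; linarith [Real.pi_gt_three]
      have hs : sKepler ≤ 1 := by
        unfold sKepler; rw [div_le_one (by linarith)]; linarith
      simpa using hs
  have hπ : 0 < π := pi_pos
  have hv0 : 0 ≤ (N : ℝ) * (4 * Real.sqrt 2) := by positivity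
  have hvol := volume_iUnion_closedBall_two_ge_kepler hK hx hN
  have hFed := Federer1969_isoperimetricUnionBalls.sphereFraction_sum_cube_of_le_volume hF
    (fun i => (2 : ℝ) • x i) two_pos hv0 hvol
  have h21 : ∀ i, exposedDirections (fun j => (2 : ℝ) • x j) 2 i = exposedCap x 1 i := fun i => by
    simpa using exposedDirections_two_smul x 1 i
  simp_rw [h21] at hFed
  have hS : ∑ i, sphereFraction (exposedCap x 1 i) = ∑ i, exposedFraction x 1 i := rfl
  rw [hS] at hFed
  set S := ∑ i, exposedFraction x 1 i with hSdef
  have hS0 : 0 ≤ S := Finset.sum_nonneg fun i _ => exposedFraction_nonneg x 1 i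
  have hc : 4 * π * (2 : ℝ) ^ 2 = cH1 := by unfold cH1; ring
  rw [hc] at hFed
  have hcpos : 0 < cH1 := cH1_pos
  set T := cH1 * S with hT
  have hT0 : 0 ≤ T := by positivity
  set Srat : ℝ := 15353 / 1000 with hSrat
  have hkey : 36 * π * ((N : ℝ) * (4 * Real.sqrt 2)) ^ 2 = (N : ℝ) ^ 2 * (1152 * π) := by
    have h2 : Real.sqrt 2 ^ 2 = 2 := Real.sq_sqrt (by norm_num)
    calc 36 * π * ((N : ℝ) * (4 * Real.sqrt 2)) ^ 2
        = 576 * π * (N : ℝ) ^ 2 * (Real.sqrt 2 ^ 2) := by ring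
      _ = (N : ℝ) ^ 2 * (1152 * π) := by rw [h2]; ring
  have hcube : (Srat * (N : ℝ) ^ ((2 : ℝ) / 3)) ^ 3 ≤ T ^ 3 := by
    have hN23 : ((N : ℝ) ^ ((2 : ℝ) / 3)) ^ 3 = (N : ℝ) ^ 2 := by
      rw [← Real.rpow_natCast, ← Real.rpow_mul (Nat.cast_nonneg N)]; norm_num
    calc (Srat * (N : ℝ) ^ ((2 : ℝ) / 3)) ^ 3 = Srat ^ 3 * (N : ℝ) ^ 2 := by rw [mul_pow, hN23]
      _ ≤ (1152 * π) * (N : ℝ) ^ 2 := mul_le_mul_of_nonneg_right sKepler_certificate (by positivity)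
      _ = 36 * π * ((N : ℝ) * (4 * Real.sqrt 2)) ^ 2 := by rw [hkey]; ring
      _ ≤ T ^ 3 := hFed
  have hTge : Srat * (N : ℝ) ^ ((2 : ℝ) / 3) ≤ T := by
    by_contra hlt
    have hlt' : T < Srat * (N : ℝ) ^ ((2 : ℝ) / 3) := not_le.1 hlt
    have : T ^ 3 < (Srat * (N : ℝ) ^ ((2 : ℝ) / 3)) ^ 3 := pow_lt_pow_left₀ hlt' hT0 (by norm_num)
    linarith
  calc sKepler * (N : ℝ) ^ ((2 : ℝ) / 3) = (Srat * (N : ℝ) ^ ((2 : ℝ) / 3)) / cH1 := by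
        simp only [sKepler, hSrat]; field_simp
    _ ≤ T / cH1 := div_le_div_of_nonneg_right hTge hcpos.le
    _ = S := by rw [hT]; field_simp

/-- **H1′ on named literature facts only (plus the cell's certified cap table)**:
`SurfaceBound (281/100)`, i.e. `C(x) < 6N - 2.81 N^{2/3}` for every packing of `N ≥ 2`
diameter-`1` balls in `ℝ³`, from the Kepler bound (doubled-balls form), Federer's inequality and
the cap input `(L)` at radius `1` with engine-2's table `FH1`. -/
theorem surfaceBound_H1K_classical (hL : LevyCapInput 1 FH1) (hK : Bezdek2002_doubledBallsUnion)
    (hF : Federer1969_isoperimetricUnionBalls) : SurfaceBound (281 / 100) :=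
  surfaceBound_H1K_rung hL (isoInput_one_of_kepler hK hF)

end Summit.Ventures.Crystal3D

end
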